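import Literature.NumberTheory.Automorphic.NewformAdelisationDescent
import Literature.NumberTheory.EllipticCurves.Newforms
import HarnessLib

/-!
# Adelisation of classical modular forms: the adjoint degeneracy maps `[Γ₁(N) diag(1,d) Γ₁(M)]` as
# finite-adelic traces, and the level of a `K₁`-fixed line (Casselman 1973 / Gelbart 1975, §3)

Topic `NumberTheory/Automorphic`; companion to `NewformAdelisationLift` (the lift `f ↦ φ_f`) and
`NewformAdelisationHeckeOperator` (Gelbart 1975, Lemma 3.7: the unramified Hecke operators on `φ_f`).
The new subspace `S_k(Γ₁(N))^{new}` of the tree (`EllipticCurves.ModularForms.newSubspace1`, Li 1975,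
Thm. 3; Diamond–Shurman Def. 5.6.1 / Ex. 5.7.2) is the joint kernel of the **adjoint degeneracy
maps** `adjDegeneracyMap1 N M d k = [Γ₁(N) diag(1,d) Γ₁(M)] : S_k(Γ₁(N)) → S_k(Γ₁(M))`
(`(M, d)` with `M` a proper divisor of `N`, `M d ∣ N`), Mathlib's trace
`∑_{r ∈ Γ₁(M)/(Γ₁(M) ∩ β⁻¹Γ₁(N)β)} (u ∣[k] β) ∣[k] r⁻¹`, `β = diag(1, d)`. This file computes their
adelisation — the same dictionary as Gelbart's Lemma 3.7 (`φ_f(g) = f(g_∞ i) j(g_∞, i)^{-k}` on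
`G_𝔸 = G_ℚ G_∞⁺ K₁(N)`, Gelbart 1975, (3.1)–(3.5), Prop. 3.1), now for a double coset between two
**different** levels:

* `adelicAdjTrace N M d φ (h) = ∑_{r} φ(h · (r_f β_f⁻¹, at the finite places))`, the sum over the same
  index set `Γ₁(M)/(Γ₁(M) ∩ β⁻¹Γ₁(N)β)` with `r_f ∈ K₁(M)` the finite-adelic image of an integral
  representative `r ∈ Γ₁(M) ≤ SL₂(ℤ)`;
* `adelicAdjTrace_mul_ofFinite` — **for `φ` right-invariant under `{1} × K₁(N)` the trace is
  right-invariant under `{1} × K₁(M)`**: left multiplication by `κ ∈ K₁(M)` permutes the classes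
  `r_f K''`, `K'' = K₁(M) ∩ β_f⁻¹ K₁(N) β_f` (`adjLevel`), because
  **`Γ₁(M)/(Γ₁(M) ∩ β⁻¹Γ₁(N)β) → K₁(M)/K''` is a bijection** (`exists_gamma1_finGL_mul_mem_adjLevel`,
  surjectivity, by strong approximation for the open subgroup `K'' ∋ diag(u, 1)`
  (`Rat.exists_generalLinearGroup_map_mul_eq`) and `GL₂(ℚ) ∩ GL₂(ℝ)⁺ K₁(M) = Γ₁(M)`
  (`Rat.exists_gamma1_of_ofGlobal_mem_plusLevelOne`); `mem_conjLevel_of_finGL_mem_adjLevel` /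
  `finGL_mem_adjLevel_of_mem_conjLevel`, injectivity, by `GL₂(ℚ) ∩ GL₂(ℝ)⁺ K₁(N) = Γ₁(N)` applied to
  `β r₁⁻¹ r₂ β⁻¹`);
* `adelicAdjTrace_adelicLiftFun_ofRealGL` — at the archimedean points,
  `adelicAdjTrace N M d φ_u ((g, 1)) = (√d)^{2-k} φ_{[Γ₁(N) β Γ₁(M)] u}((g, 1))`: for each `r`,
  `φ_u((g, r_f β_f⁻¹)) = φ_u((β r⁻¹ g, 1))` by left `GL₂(ℚ)`-invariance under `β r⁻¹`, and
  `archLift k u (β r⁻¹ g) = (√d)^{2-k} archLift k ((u|β)|r⁻¹) g`;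
* `adelicAdjTrace_adelicLiftFun` — hence **`adelicAdjTrace N M d φ_u = (√d)^{2-k} φ_{[Γ₁(N) β Γ₁(M)] u}`**
  on all of `GL₂(𝔸_ℚ)` (both sides are left `GL₂(ℚ)`- and right `{1} × K₁(M)`-invariant,
  `eq_of_invariant_of_ofRealGL`);
* `adjDegeneracyMap1_eq_zero_of_forall_fixed`, `mem_newSubspace1_of_forall_fixed` — **the level of a
  `K₁`-line is new**: if `φ_u` lies in a space `C` of functions on `GL₂(𝔸_ℚ)` stable under right
  translation by `GL₂(𝔸_ℚ^∞)` in which, for every proper divisor `M` of `N`, the only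
  `{1} × K₁(M)`-invariant function is `0`, then `u ∈ S_k(Γ₁(N))^{new}` — the trace lies in `C` and is
  `K₁(M)`-invariant, so `φ_{[Γ₁(N) β Γ₁(M)] u} = 0`, so `[Γ₁(N) β Γ₁(M)] u = 0` (`f ↦ φ_f` is injective,
  `CuspForm.eq_zero_of_adelicLiftFun_eq_zero`). This is the adelic reading of "the conductor of `π` is
  the exact level of its new vector" in the direction needed for Gelbart's dictionary `π ↦ f_π`
  (Gelbart 1975, Thm. 5.19 (b) with Remark 4.25; Casselman 1973, Thm. 1): a `K₁(N)`-fixed vector of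
  an irreducible `π` at the minimal such `N` descends to the new subspace.

Everything is proved; the definitions are the explicit matrix `degBeta d = diag(1, d)`, the finite-adelic
image `Rat.finGL`, the two level groups `conjLevel`, `adjLevel`, the integral representative `slOf` and
the trace `adelicAdjTrace` (no named fact).

## References

* S. Gelbart, *Automorphic forms on adele groups*, Ann. of Math. Stud. 83 (1975), §3.A (3.1)–(3.5),
  Prop. 3.1, Lemma 3.7; Thm. 5.19 and Remark 4.25 [Gelbart1975].
* W. Casselman, *On some results of Atkin and Lehner*, Math. Ann. 201 (1973), 301–314, Thm. 1
  [Casselman1973].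
* W.-C. W. Li, *Newforms and functional equations*, Math. Ann. 212 (1975), §2 (the maps
  `[Γ₁(N) diag(1,d) Γ₁(M)]`), Thm. 3 [Li1975].
* F. Diamond, J. Shurman, *A first course in modular forms*, GTM 228 (2005), §5.1 (double coset
  operators), Def. 5.6.1, Ex. 5.7.2 [DiamondShurman2005].
-/

noncomputable section

open Matrix NumberField IsDedekindDomain UpperHalfPlane
open scoped MatrixGroups ModularForm NNReal Pointwise
open ConjAct

namespace Literature.NumberTheory.Automorphic

open EllipticCurves.ModularForms CongruenceSubgroup Matrix.SpecialLinearGroup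

/-! ### The finite-adelic image of a global element; `g = (g_ℚ)_∞ (g_ℚ)_f` -/

section FinGL

/-- The finite-adelic image `γ_f ∈ GL₂(𝔸_ℚ^∞)` of `γ ∈ GL₂(ℚ)` (the finite part of the diagonal
embedding). [cite: Gelbart1975, §3.A] -/
def Rat.finGL : GL (Fin 2) ℚ →* GL (Fin 2) (FiniteAdeleRing (𝓞 ℚ) ℚ) :=
  (GLn.sndHom 2 ℚ).comp (GLn.ofGlobal 2 ℚ)

/-- Unfolding `Rat.finGL`. [folklore] -/
theorem Rat.finGL_apply (γ : GL (Fin 2) ℚ) : Rat.finGL γ = GLn.sndHom 2 ℚ (GLn.ofGlobal 2 ℚ γ) := rfl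

/-- `γ_f` is the entrywise image of `γ` under `ℚ → 𝔸_ℚ^∞`. [folklore] -/
theorem Rat.finGL_eq_map (γ : GL (Fin 2) ℚ) :
    Rat.finGL γ = Matrix.GeneralLinearGroup.map (algebraMap ℚ (FiniteAdeleRing (𝓞 ℚ) ℚ)) γ := by
  rw [Rat.finGL_apply, Rat.sndHom_ofGlobal]

/-- **`γ = (γ_∞, 1) (1, γ_f)`** for `γ ∈ GL₂(ℚ)` diagonally embedded (Gelbart 1975, §3.A).
[cite: Gelbart1975, §3.A] -/
theorem Rat.ofGlobal_eq_ofRealGL_mul_ofFinite (γ : GL (Fin 2) ℚ) :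
    GLn.ofGlobal 2 ℚ γ = Rat.ofRealGL 2 (glCast γ) * GLn.ofFinite 2 ℚ (Rat.finGL γ) := by
  conv_lhs => rw [← Rat.ofRealGL_archGL_mul_ofFinite_sndHom 2 (GLn.ofGlobal 2 ℚ γ)]
  rw [Rat.archGL_ofGlobal]
  rfl

/-- `(1, h)` has trivial archimedean part. [folklore] -/
theorem Rat.archGL_ofFinite (h : GL (Fin 2) (FiniteAdeleRing (𝓞 ℚ) ℚ)) :
    Rat.archGL 2 (GLn.ofFinite 2 ℚ h) = 1 := by
  rw [Rat.archGL, MonoidHom.comp_apply, GLn.fstHom_ofFinite, map_one]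

/-- The determinant of the real image of `γ ∈ GL₂(ℚ)` is `det γ`. [folklore] -/
theorem Rat.val_det_glCast (γ : GL (Fin 2) ℚ) : (glCast γ).det.val = ((γ.det.val : ℚ) : ℝ) := by
  rw [Matrix.GeneralLinearGroup.map_det, Units.coe_map, MonoidHom.coe_coe, Rat.coe_castHom]

/-- `γ ∈ GL₂(ℚ)` with `det γ > 0` and `γ_f ∈ K₁(N)` lies in `Γ₁(N)`
(`Rat.exists_gamma1_of_ofGlobal_mem_plusLevelOne`). [cite: Gelbart1975, (3.5)] -/
theorem Rat.exists_gamma1_of_finGL_mem {N : ℕ} [NeZero N] {γ : GL (Fin 2) ℚ} (hdet : 0 < γ.det.val)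
    (hγ : Rat.finGL γ ∈ gammaOneFiniteLevel ℚ (Ideal.span {(N : 𝓞 ℚ)})) :
    ∃ A : SL(2, ℤ), A ∈ Gamma1 N ∧ mapGL ℚ A = γ := by
  refine Rat.exists_gamma1_of_ofGlobal_mem_plusLevelOne ?_
  rw [Rat.mem_plusLevelOne_iff, Rat.archGL_ofGlobal]
  refine ⟨?_, hγ⟩
  rw [show Matrix.GeneralLinearGroup.map (Rat.castHom ℝ) γ = glCast γ from rfl, Rat.val_det_glCast]
  exact_mod_cast hdet

/-- For `A ∈ Γ₁(N) ≤ SL₂(ℤ)`, `A_f ∈ K₁(N)`. [cite: Gelbart1975, (3.5)] -/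
theorem Rat.finGL_mapGL_mem {N : ℕ} [NeZero N] {A : SL(2, ℤ)} (hA : A ∈ Gamma1 N) :
    Rat.finGL (mapGL ℚ A) ∈ gammaOneFiniteLevel ℚ (Ideal.span {(N : 𝓞 ℚ)}) :=
  Rat.sndHom_ofGlobal_mapGL_mem hA

/-- `glCast (mapGL ℚ A) = mapGL ℝ A`. [folklore] -/
theorem glCast_mapGL (A : SL(2, ℤ)) : glCast (mapGL ℚ A) = mapGL ℝ A := Rat.map_castHom_mapGL A

/-- `glCast` is multiplicative (it is `GeneralLinearGroup.map`). [folklore] -/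
theorem glCast_mul (a b : GL (Fin 2) ℚ) : glCast (a * b) = glCast a * glCast b := map_mul _ a b

/-- `glCast` commutes with inversion. [folklore] -/
theorem glCast_inv (a : GL (Fin 2) ℚ) : glCast a⁻¹ = (glCast a)⁻¹ := map_inv _ a

/-- `glCast` is injective (`ℚ → ℝ` is). [folklore] -/
theorem glCast_injective : Function.Injective (glCast : GL (Fin 2) ℚ → GL (Fin 2) ℝ) := by
  intro a b h
  ext i j
  have hij := congrArg (fun g : GL (Fin 2) ℝ => (g : Matrix (Fin 2) (Fin 2) ℝ) i j) h
  simp only [Matrix.GeneralLinearGroup.map_apply, Rat.coe_castHom] at hij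
  exact_mod_cast hij

end FinGL

/-! ### Uniqueness of an adelic function from its archimedean values -/

section Unique

variable {M : ℕ} [NeZero M]

omit [NeZero M] in
/-- **A left `GL₂(ℚ)`-invariant, right `{1} × K₁(M)`-invariant function is determined by its values
at the `(g, 1)`, `det g > 0`** (`G_𝔸 = G_ℚ G_∞⁺ K₁(M)`, Gelbart 1975, (3.1);
`Rat.exists_ofGlobal_inv_mul_mem_plusLevelOne`). [cite: Gelbart1975, (3.1)] -/
theorem eq_of_invariant_of_ofRealGL {F₁ F₂ : GL (Fin 2) (AdeleRing (𝓞 ℚ) ℚ) → ℂ}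
    (hl₁ : ∀ (γ : GL (Fin 2) ℚ) (g : GL (Fin 2) (AdeleRing (𝓞 ℚ) ℚ)), F₁ (GLn.ofGlobal 2 ℚ γ * g) = F₁ g)
    (hl₂ : ∀ (γ : GL (Fin 2) ℚ) (g : GL (Fin 2) (AdeleRing (𝓞 ℚ) ℚ)), F₂ (GLn.ofGlobal 2 ℚ γ * g) = F₂ g)
    (hr₁ : ∀ κ ∈ gammaOneFiniteLevel ℚ (Ideal.span {(M : 𝓞 ℚ)}), ∀ g : GL (Fin 2) (AdeleRing (𝓞 ℚ) ℚ),
      F₁ (g * GLn.ofFinite 2 ℚ κ) = F₁ g)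
    (hr₂ : ∀ κ ∈ gammaOneFiniteLevel ℚ (Ideal.span {(M : 𝓞 ℚ)}), ∀ g : GL (Fin 2) (AdeleRing (𝓞 ℚ) ℚ),
      F₂ (g * GLn.ofFinite 2 ℚ κ) = F₂ g)
    (h : ∀ g : GL (Fin 2) ℝ, 0 < g.det.val → F₁ (Rat.ofRealGL 2 g) = F₂ (Rat.ofRealGL 2 g)) :
    F₁ = F₂ := by
  funext x
  obtain ⟨γ, hγ⟩ := Rat.exists_ofGlobal_inv_mul_mem_plusLevelOne (Ideal.span {(M : 𝓞 ℚ)}) x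
  rw [Rat.mem_plusLevelOne_iff] at hγ
  set y : GL (Fin 2) (AdeleRing (𝓞 ℚ) ℚ) := (GLn.ofGlobal 2 ℚ γ)⁻¹ * x with hy
  have hx : x = GLn.ofGlobal 2 ℚ γ * y := by rw [hy, mul_inv_cancel_left]
  have hy' : y = Rat.ofRealGL 2 (Rat.archGL 2 y) * GLn.ofFinite 2 ℚ (GLn.sndHom 2 ℚ y) :=
    (Rat.ofRealGL_archGL_mul_ofFinite_sndHom 2 y).symm
  calc F₁ x = F₁ y := by rw [hx, hl₁]
    _ = F₁ (Rat.ofRealGL 2 (Rat.archGL 2 y)) := by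
        conv_lhs => rw [hy']
        rw [hr₁ _ hγ.2]
    _ = F₂ (Rat.ofRealGL 2 (Rat.archGL 2 y)) := h _ hγ.1
    _ = F₂ y := by
        conv_rhs => rw [hy']
        rw [hr₂ _ hγ.2]
    _ = F₂ x := by rw [hx, hl₂]

/-- **`f ↦ φ_f` is injective**: a cusp form whose adelic lift vanishes is zero
(`φ_f((g, 1)) = archLift k f g`, `archDescent_archLift`; Gelbart 1975, Prop. 3.1 / Gelbart 1997,
Prop. 2.5, sketch of proof: "`f ↦ φ_f` is an isomorphism"). [cite: Gelbart1975, Prop. 3.1] -/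
theorem CuspForm.eq_zero_of_adelicLiftFun_eq_zero {k : ℤ} {F : CuspForm (Gamma1 M) k}
    (h : adelicLiftFun M k ⇑F = 0) : F = 0 := by
  apply DFunLike.coe_injective
  rw [← archDescent_archLift k ⇑F, CuspForm.coe_zero, ← archDescent_archLift k (0 : ℍ → ℂ)]
  refine archDescent_congr k fun g hg => ?_
  rw [← adelicLiftFun_ofRealGL F hg, h, Pi.zero_apply, archLift_apply, SlashAction.zero_slash,
    Pi.zero_apply, zero_mul]

end Unique

/-! ### `β = diag(1, d)`, the level groups `Γ₁(M) ∩ β⁻¹Γ₁(N)β` and `K₁(M) ∩ β_f⁻¹K₁(N)β_f` -/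

section Levels

variable (N M d : ℕ) [NeZero N] [NeZero M] [NeZero d]

/-- `β = diag(1, d) ∈ GL₂(ℚ)⁺`, the matrix of the degeneracy correspondences `[Γ₁(N) β Γ₁(M)]`
(Li 1975, §2; Diamond–Shurman §5.6–5.7; the tree's `adjDegeneracyMap1`). [cite: Li1975, §2] -/
def degBeta : GL(2, ℚ)⁺ := diagGL 1 d one_pos (Nat.cast_pos.mpr (NeZero.pos d))

/-- The matrix of `β`. [folklore] -/
theorem coe_degBeta : ((degBeta d : GL (Fin 2) ℚ) : Matrix (Fin 2) (Fin 2) ℚ) = !![1, 0; 0, (d : ℚ)] :=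
  coe_coe_diagGL _ _ _ _

/-- `d` as a unit of `ℚ`. [folklore] -/
def degUnit : ℚˣ := Units.mk0 (d : ℚ) (Nat.cast_ne_zero.mpr (NeZero.ne d))

/-- `β = glDiagonal (1, d)`. [folklore] -/
theorem degBeta_eq_glDiagonal : (degBeta d : GL (Fin 2) ℚ) = glDiagonal 2 ℚ ![1, degUnit d] := by
  ext i j
  rw [coe_degBeta, coe_glDiagonal]
  fin_cases i <;> fin_cases j <;> rfl

/-- `det β = d > 0` over `ℝ`. [folklore] -/
theorem det_glCast_degBeta : (glCast (degBeta d : GL (Fin 2) ℚ)).det.val = d := by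
  rw [Rat.val_det_glCast, Matrix.GeneralLinearGroup.val_det_apply, coe_degBeta, Matrix.det_fin_two_of]
  push_cast
  ring

/-- `β_f = glDiagonal (1, d)` in `GL₂(𝔸_ℚ^∞)`. [folklore] -/
theorem finGL_degBeta : Rat.finGL (degBeta d : GL (Fin 2) ℚ) =
    glDiagonal 2 (FiniteAdeleRing (𝓞 ℚ) ℚ)
      ![1, Units.map (algebraMap ℚ (FiniteAdeleRing (𝓞 ℚ) ℚ) : ℚ →* FiniteAdeleRing (𝓞 ℚ) ℚ) (degUnit d)] := by
  rw [Rat.finGL_eq_map, degBeta_eq_glDiagonal, map_glDiagonal]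
  congr 1
  funext i
  fin_cases i
  · simp
  · rfl

/-- Diagonal elements of `GL_n` commute. [folklore] -/
theorem commute_glDiagonal {n : ℕ} {R : Type*} [CommRing R] (a b : Fin n → Rˣ) :
    Commute (glDiagonal n R a) (glDiagonal n R b) := by
  rw [Commute, SemiconjBy, ← map_mul, ← map_mul, mul_comm]

/-- **`Γ₁(N)^β = β⁻¹ Γ₁(N) β ≤ GL₂(ℝ)`**, the level of `u ∣[k] β` for `u ∈ S_k(Γ₁(N))` (Mathlib
`CuspForm.translate`). [cite: DiamondShurman2005, §5.1] -/
abbrev conjLevel : Subgroup (GL (Fin 2) ℝ) :=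
  toConjAct (glCast (degBeta d : GL (Fin 2) ℚ))⁻¹ • ((Gamma1 N : Subgroup SL(2, ℤ)) : Subgroup (GL (Fin 2) ℝ))

omit [NeZero N] in
/-- Membership in `β⁻¹ Γ₁(N) β`: `x ∈ β⁻¹Γ₁(N)β ↔ β x β⁻¹ ∈ Γ₁(N)`. [folklore] -/
theorem mem_conjLevel_iff {x : GL (Fin 2) ℝ} : x ∈ conjLevel N d ↔
    glCast (degBeta d : GL (Fin 2) ℚ) * x * (glCast (degBeta d : GL (Fin 2) ℚ))⁻¹ ∈
      ((Gamma1 N : Subgroup SL(2, ℤ)) : Subgroup (GL (Fin 2) ℝ)) := by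
  rw [conjLevel, toConjAct_inv, Subgroup.mem_inv_pointwise_smul_iff, toConjAct_smul]

/-- **`K'' = K₁(M) ∩ β_f⁻¹ K₁(N) β_f ≤ GL₂(𝔸_ℚ^∞)`**, the finite-adelic counterpart of
`Γ₁(M) ∩ β⁻¹Γ₁(N)β`. [cite: Gelbart1975, §3.A] -/
def adjLevel : Subgroup (GL (Fin 2) (FiniteAdeleRing (𝓞 ℚ) ℚ)) :=
  gammaOneFiniteLevel ℚ (Ideal.span {(M : 𝓞 ℚ)}) ⊓
    (toConjAct (Rat.finGL (degBeta d : GL (Fin 2) ℚ)))⁻¹ • gammaOneFiniteLevel ℚ (Ideal.span {(N : 𝓞 ℚ)})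

omit [NeZero N] [NeZero M] in
/-- Membership in `K''`. [folklore] -/
theorem mem_adjLevel_iff {x : GL (Fin 2) (FiniteAdeleRing (𝓞 ℚ) ℚ)} : x ∈ adjLevel N M d ↔
    x ∈ gammaOneFiniteLevel ℚ (Ideal.span {(M : 𝓞 ℚ)}) ∧
      Rat.finGL (degBeta d : GL (Fin 2) ℚ) * x * (Rat.finGL (degBeta d : GL (Fin 2) ℚ))⁻¹ ∈
        gammaOneFiniteLevel ℚ (Ideal.span {(N : 𝓞 ℚ)}) := by
  rw [adjLevel, Subgroup.mem_inf, Subgroup.mem_inv_pointwise_smul_iff, toConjAct_smul]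

omit [NeZero N] [NeZero M] in
/-- `K''` is open. [folklore] -/
theorem isOpen_adjLevel : IsOpen (adjLevel N M d : Set (GL (Fin 2) (FiniteAdeleRing (𝓞 ℚ) ℚ))) := by
  have hcont : Continuous fun x : GL (Fin 2) (FiniteAdeleRing (𝓞 ℚ) ℚ) =>
      Rat.finGL (degBeta d : GL (Fin 2) ℚ) * x * (Rat.finGL (degBeta d : GL (Fin 2) ℚ))⁻¹ :=
    (continuous_const.mul continuous_id).mul continuous_const
  have e : (adjLevel N M d : Set (GL (Fin 2) (FiniteAdeleRing (𝓞 ℚ) ℚ))) =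
      (gammaOneFiniteLevel ℚ (Ideal.span {(M : 𝓞 ℚ)}) : Set (GL (Fin 2) (FiniteAdeleRing (𝓞 ℚ) ℚ))) ∩
        (fun x => Rat.finGL (degBeta d : GL (Fin 2) ℚ) * x * (Rat.finGL (degBeta d : GL (Fin 2) ℚ))⁻¹) ⁻¹'
          (gammaOneFiniteLevel ℚ (Ideal.span {(N : 𝓞 ℚ)}) : Set (GL (Fin 2) (FiniteAdeleRing (𝓞 ℚ) ℚ))) := by
    ext x
    simp only [SetLike.mem_coe, mem_adjLevel_iff, Set.mem_inter_iff, Set.mem_preimage]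
  rw [e]
  exact (isOpen_gammaOneFiniteLevel _).inter ((isOpen_gammaOneFiniteLevel _).preimage hcont)

omit [NeZero N] [NeZero M] in
/-- `diag(u, 1) ∈ K''` for `u ∈ Ẑˣ` (it lies in `K₁(M)` and commutes with `β_f`), so `det K'' = Ẑˣ`
— the hypothesis of strong approximation (`Rat.exists_generalLinearGroup_map_mul_eq`).
[cite: Gelbart1975, (3.1)] -/
theorem glDiagonal_mem_adjLevel {u : (FiniteAdeleRing (𝓞 ℚ) ℚ)ˣ} (hu : ∀ v, Valued.v ((u : FiniteAdeleRing (𝓞 ℚ) ℚ) v) = 1) :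
    glDiagonal 2 (FiniteAdeleRing (𝓞 ℚ) ℚ) ![u, 1] ∈ adjLevel N M d := by
  rw [mem_adjLevel_iff]
  refine ⟨glDiagonal_mem_gammaOneFiniteLevel _ hu, ?_⟩
  rw [finGL_degBeta, (commute_glDiagonal _ _).eq, mul_inv_cancel_right]
  exact glDiagonal_mem_gammaOneFiniteLevel _ hu

omit [NeZero N] [NeZero M] in
/-- `ε_f ∈ K''` for the sign matrix `ε = diag(-1, 1)`. [folklore] -/
theorem finGL_signGL_mem_adjLevel : Rat.finGL Rat.signGL ∈ adjLevel N M d := by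
  rw [mem_adjLevel_iff]
  have hcomm : Commute (degBeta d : GL (Fin 2) ℚ) Rat.signGL := by
    rw [degBeta_eq_glDiagonal, Rat.signGL]
    exact commute_glDiagonal _ _
  refine ⟨Rat.sndHom_signGL_mem _, ?_⟩
  rw [(hcomm.map Rat.finGL).eq, mul_inv_cancel_right]
  exact Rat.sndHom_signGL_mem _

end Levels

/-! ### `Γ₁(M)/(Γ₁(M) ∩ β⁻¹Γ₁(N)β) ≅ K₁(M)/K''` -/

section Bijection

variable {N M d : ℕ} [NeZero N] [NeZero M] [NeZero d]

omit [NeZero N] in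
/-- **Surjectivity of `Γ₁(M) → K₁(M)/K''`**: every `κ ∈ K₁(M)` is `A_f k''` with `A ∈ Γ₁(M)` and
`k'' ∈ K''`. Proof: strong approximation for the open subgroup `K'' ∋ diag(u,1)` writes
`κ = γ_f k''` with `γ ∈ GL₂(ℚ)`; replacing `(γ, k'')` by `(γ ε, ε_f⁻¹ k'')` if needed, `det γ > 0`;
then `γ_f = κ k''⁻¹ ∈ K₁(M)` forces `γ ∈ Γ₁(M)` (`GL₂(ℚ) ∩ GL₂(ℝ)⁺ K₁(M) = Γ₁(M)`).
[cite: Gelbart1975, (3.1) and (3.5)] -/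
theorem exists_gamma1_finGL_mul_mem_adjLevel {κ : GL (Fin 2) (FiniteAdeleRing (𝓞 ℚ) ℚ)}
    (hκ : κ ∈ gammaOneFiniteLevel ℚ (Ideal.span {(M : 𝓞 ℚ)})) :
    ∃ A : SL(2, ℤ), A ∈ Gamma1 M ∧ ∃ k'' ∈ adjLevel N M d, Rat.finGL (mapGL ℚ A) * k'' = κ := by
  -- strong approximation, then fix the sign of `det γ`
  have key : ∃ (γ : GL (Fin 2) ℚ) (k'' : GL (Fin 2) (FiniteAdeleRing (𝓞 ℚ) ℚ)),
      0 < γ.det.val ∧ k'' ∈ adjLevel N M d ∧ Rat.finGL γ * k'' = κ := by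
    obtain ⟨γ, k'', hk'', hγk⟩ := Rat.exists_generalLinearGroup_map_mul_eq (adjLevel N M d)
      (isOpen_adjLevel N M d) (fun _ hu => glDiagonal_mem_adjLevel N M d hu) κ
    rw [← Rat.finGL_eq_map] at hγk
    rcases lt_or_gt_of_ne γ.det.ne_zero with hneg | hpos
    · refine ⟨γ * Rat.signGL, (Rat.finGL Rat.signGL)⁻¹ * k'', ?_, ?_, ?_⟩
      · rw [map_mul, Units.val_mul]
        have hε : (Rat.signGL.det.val : ℚ) = -1 := by
          rw [Rat.signGL, det_glDiagonal_eq_prod, Fin.prod_univ_two]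
          simp
        rw [hε, mul_neg_one]
        exact neg_pos.2 hneg
      · exact mul_mem (inv_mem (finGL_signGL_mem_adjLevel N M d)) hk''
      · rw [map_mul, mul_assoc, mul_inv_cancel_left, hγk]
    · exact ⟨γ, k'', hpos, hk'', hγk⟩
  obtain ⟨γ, k'', hdet, hk'', hγk⟩ := key
  have hγK : Rat.finGL γ ∈ gammaOneFiniteLevel ℚ (Ideal.span {(M : 𝓞 ℚ)}) := by
    have e : Rat.finGL γ = κ * k''⁻¹ := by rw [← hγk, mul_inv_cancel_right]
    rw [e]
    exact mul_mem hκ (inv_mem ((mem_adjLevel_iff N M d).1 hk'').1)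
  obtain ⟨A, hA, hAγ⟩ := Rat.exists_gamma1_of_finGL_mem hdet hγK
  exact ⟨A, hA, k'', hk'', by rw [hAγ, hγk]⟩

omit [NeZero M] in
/-- **Injectivity of `Γ₁(M)/(Γ₁(M) ∩ β⁻¹Γ₁(N)β) → K₁(M)/K''`**: if `A₁, A₂ ∈ Γ₁(M)` have
`A_{1,f}⁻¹ A_{2,f} ∈ K''`, then `A₁⁻¹ A₂ ∈ β⁻¹ Γ₁(N) β` — because `β A₁⁻¹ A₂ β⁻¹ ∈ GL₂(ℚ)` has
determinant `1` and finite part in `K₁(N)`, hence lies in `Γ₁(N)`. [cite: Gelbart1975, (3.5)] -/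
theorem mem_conjLevel_of_finGL_mem_adjLevel {A₁ A₂ : SL(2, ℤ)}
    (h : (Rat.finGL (mapGL ℚ A₁))⁻¹ * Rat.finGL (mapGL ℚ A₂) ∈ adjLevel N M d) :
    (mapGL ℝ A₁ : GL (Fin 2) ℝ)⁻¹ * mapGL ℝ A₂ ∈ conjLevel N d := by
  set β : GL (Fin 2) ℚ := (degBeta d : GL (Fin 2) ℚ) with hβ
  set γ : GL (Fin 2) ℚ := β * ((mapGL ℚ A₁)⁻¹ * mapGL ℚ A₂) * β⁻¹ with hγ
  have hγf : Rat.finGL γ ∈ gammaOneFiniteLevel ℚ (Ideal.span {(N : 𝓞 ℚ)}) := by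
    have e : Rat.finGL γ = Rat.finGL β * ((Rat.finGL (mapGL ℚ A₁))⁻¹ * Rat.finGL (mapGL ℚ A₂)) *
        (Rat.finGL β)⁻¹ := by
      rw [hγ, map_mul, map_mul, map_mul, map_inv, map_inv]
    rw [e]
    exact ((mem_adjLevel_iff N M d).1 h).2
  have hdet : 0 < γ.det.val := by
    rw [hγ, map_mul, map_mul, map_inv, map_mul, map_inv, mul_inv_cancel_comm, Units.val_mul,
      Units.val_inv_eq_inv_val]
    have h1 : ∀ A : SL(2, ℤ), ((mapGL ℚ A : GL (Fin 2) ℚ).det.val : ℚ) = 1 := fun A => by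
      rw [Matrix.GeneralLinearGroup.val_det_apply]
      change ((A : Matrix (Fin 2) (Fin 2) ℤ).map (Int.castRingHom ℚ)).det = 1
      rw [← RingHom.mapMatrix_apply, ← RingHom.map_det, A.det_coe, map_one]
    rw [h1, h1]
    norm_num
  obtain ⟨B, hB, hBγ⟩ := Rat.exists_gamma1_of_finGL_mem hdet hγf
  rw [mem_conjLevel_iff]
  have e : glCast β * ((mapGL ℝ A₁ : GL (Fin 2) ℝ)⁻¹ * mapGL ℝ A₂) * (glCast β)⁻¹ = glCast γ := by
    rw [hγ, glCast_mul, glCast_mul, glCast_inv, glCast_mul, glCast_inv, glCast_mapGL, glCast_mapGL]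
  rw [e, ← hBγ, glCast_mapGL]
  exact Subgroup.mem_map_of_mem _ hB

/-- Conversely, **if `A₁, A₂ ∈ Γ₁(M)` and `A₁⁻¹ A₂ ∈ β⁻¹ Γ₁(N) β` then `A_{1,f}⁻¹ A_{2,f} ∈ K''`**
(`Γ₁(N)_f ⊆ K₁(N)`). [cite: Gelbart1975, (3.5)] -/
theorem finGL_mem_adjLevel_of_mem_conjLevel {A₁ A₂ : SL(2, ℤ)} (h₁ : A₁ ∈ Gamma1 M) (h₂ : A₂ ∈ Gamma1 M)
    (h : (mapGL ℝ A₁ : GL (Fin 2) ℝ)⁻¹ * mapGL ℝ A₂ ∈ conjLevel N d) :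
    (Rat.finGL (mapGL ℚ A₁))⁻¹ * Rat.finGL (mapGL ℚ A₂) ∈ adjLevel N M d := by
  rw [mem_adjLevel_iff]
  refine ⟨mul_mem (inv_mem (Rat.finGL_mapGL_mem h₁)) (Rat.finGL_mapGL_mem h₂), ?_⟩
  rw [mem_conjLevel_iff] at h
  obtain ⟨B, hB, hBe⟩ := Subgroup.mem_map.mp h
  set β : GL (Fin 2) ℚ := (degBeta d : GL (Fin 2) ℚ) with hβ
  -- the rational identity `B = β A₁⁻¹ A₂ β⁻¹`
  have hrat : mapGL ℚ B = β * ((mapGL ℚ A₁)⁻¹ * mapGL ℚ A₂) * β⁻¹ := by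
    apply glCast_injective
    rw [glCast_mapGL, glCast_mul, glCast_mul, glCast_inv, glCast_mul, glCast_inv, glCast_mapGL, glCast_mapGL]
    exact hBe
  have e : Rat.finGL β * ((Rat.finGL (mapGL ℚ A₁))⁻¹ * Rat.finGL (mapGL ℚ A₂)) * (Rat.finGL β)⁻¹ =
      Rat.finGL (mapGL ℚ B) := by
    rw [hrat, map_mul, map_mul, map_mul, map_inv, map_inv]
  rw [e]
  exact Rat.finGL_mapGL_mem hB

end Bijection

/-! ### Integral representatives -/

section Reps

/-- An integral representative `A ∈ Γ₁(M) ≤ SL₂(ℤ)` of `r ∈ Γ₁(M) ≤ GL₂(ℝ)` (a choice; unique in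
fact). [folklore] -/
def slOf (M : ℕ) (r : ((Gamma1 M : Subgroup SL(2, ℤ)) : Subgroup (GL (Fin 2) ℝ))) : SL(2, ℤ) :=
  (Subgroup.mem_map.mp r.2).choose

variable {M : ℕ}

/-- `slOf r ∈ Γ₁(M)`. [folklore] -/
theorem slOf_mem (r : ((Gamma1 M : Subgroup SL(2, ℤ)) : Subgroup (GL (Fin 2) ℝ))) : slOf M r ∈ Gamma1 M :=
  (Subgroup.mem_map.mp r.2).choose_spec.1

/-- `slOf r` maps to `r`. [folklore] -/
theorem mapGL_slOf (r : ((Gamma1 M : Subgroup SL(2, ℤ)) : Subgroup (GL (Fin 2) ℝ))) :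
    (mapGL ℝ (slOf M r) : GL (Fin 2) ℝ) = r :=
  (Subgroup.mem_map.mp r.2).choose_spec.2

end Reps

/-! ### The finite-adelic trace -/

section Trace

variable (N M d : ℕ) [NeZero N] [NeZero M] [NeZero d]

/-- The index set `Γ₁(M) / (Γ₁(M) ∩ β⁻¹Γ₁(N)β)` of Mathlib's trace defining
`[Γ₁(N) β Γ₁(M)] = adjDegeneracyMap1 N M d k`. [cite: DiamondShurman2005, §5.1] -/
abbrev DegQuot : Type :=
  ((Gamma1 M : Subgroup SL(2, ℤ)) : Subgroup (GL (Fin 2) ℝ)) ⧸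
    (conjLevel N d).subgroupOf ((Gamma1 M : Subgroup SL(2, ℤ)) : Subgroup (GL (Fin 2) ℝ))

/-- The finite-adelic element `r_f β_f⁻¹` attached to a class `q = r (Γ₁(M) ∩ β⁻¹Γ₁(N)β)` (through
the representative `q.out`). [cite: Gelbart1975, §3.A] -/
def degElt (q : DegQuot N M d) : GL (Fin 2) (FiniteAdeleRing (𝓞 ℚ) ℚ) :=
  Rat.finGL (mapGL ℚ (slOf M q.out)) * (Rat.finGL (degBeta d : GL (Fin 2) ℚ))⁻¹

/-- **The finite-adelic trace** `T φ (h) = ∑_{q} φ(h · (1, r_{q,f} β_f⁻¹))` over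
`q ∈ Γ₁(M)/(Γ₁(M) ∩ β⁻¹Γ₁(N)β)`, the adelic form of the double coset operator `[Γ₁(N) β Γ₁(M)]`
(Gelbart 1975, Lemma 3.7, there for `[Γ₀(N) diag(p,1) Γ₀(N)]`). [cite: Gelbart1975, Lemma 3.7] -/
def adelicAdjTrace (φ : GL (Fin 2) (AdeleRing (𝓞 ℚ) ℚ) → ℂ) (h : GL (Fin 2) (AdeleRing (𝓞 ℚ) ℚ)) : ℂ :=
  letI := Fintype.ofFinite (DegQuot N M d)
  ∑ q : DegQuot N M d, φ (h * GLn.ofFinite 2 ℚ (degElt N M d q))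

variable {N M d}

omit [NeZero N] [NeZero M] in
/-- Two elements of `K₁(M)` in the same class modulo `K''` give the same summand on a right
`{1} × K₁(N)`-invariant `φ`: `φ(h (y β_f⁻¹)) = φ(h (x β_f⁻¹) · β_f (x⁻¹ y) β_f⁻¹)`. [folklore] -/
theorem apply_mul_ofFinite_eq_of_inv_mul_mem_adjLevel {φ : GL (Fin 2) (AdeleRing (𝓞 ℚ) ℚ) → ℂ}
    (hφ : ∀ κ ∈ gammaOneFiniteLevel ℚ (Ideal.span {(N : 𝓞 ℚ)}), ∀ g : GL (Fin 2) (AdeleRing (𝓞 ℚ) ℚ),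
      φ (g * GLn.ofFinite 2 ℚ κ) = φ g)
    {x y : GL (Fin 2) (FiniteAdeleRing (𝓞 ℚ) ℚ)} (hxy : x⁻¹ * y ∈ adjLevel N M d)
    (h : GL (Fin 2) (AdeleRing (𝓞 ℚ) ℚ)) :
    φ (h * GLn.ofFinite 2 ℚ (y * (Rat.finGL (degBeta d : GL (Fin 2) ℚ))⁻¹)) =
      φ (h * GLn.ofFinite 2 ℚ (x * (Rat.finGL (degBeta d : GL (Fin 2) ℚ))⁻¹)) := by
  set βf := Rat.finGL (degBeta d : GL (Fin 2) ℚ) with hβf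
  have e : y * βf⁻¹ = (x * βf⁻¹) * (βf * (x⁻¹ * y) * βf⁻¹) := by group
  rw [e, map_mul, ← mul_assoc, hφ _ ((mem_adjLevel_iff N M d).1 hxy).2]

/-- **Right `{1} × K₁(M)`-invariance of the trace of a right `{1} × K₁(N)`-invariant `φ`**: left
multiplication by `κ ∈ K₁(M)` permutes the classes `r_f K''` (the map
`Γ₁(M)/(Γ₁(M) ∩ β⁻¹Γ₁(N)β) → K₁(M)/K''` is a bijection: `exists_gamma1_finGL_mul_mem_adjLevel`,
`mem_conjLevel_of_finGL_mem_adjLevel`, `finGL_mem_adjLevel_of_mem_conjLevel`), and `φ` does not see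
the factor in `β_f K'' β_f⁻¹ ⊆ K₁(N)` (Gelbart 1975, proof of Lemma 3.7; Diamond–Shurman §5.1:
a double coset operator does not depend on the orbit representatives). [cite: Gelbart1975, Lemma 3.7] -/
theorem adelicAdjTrace_mul_ofFinite {φ : GL (Fin 2) (AdeleRing (𝓞 ℚ) ℚ) → ℂ}
    (hφ : ∀ κ ∈ gammaOneFiniteLevel ℚ (Ideal.span {(N : 𝓞 ℚ)}), ∀ g : GL (Fin 2) (AdeleRing (𝓞 ℚ) ℚ),
      φ (g * GLn.ofFinite 2 ℚ κ) = φ g)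
    {κ : GL (Fin 2) (FiniteAdeleRing (𝓞 ℚ) ℚ)} (hκ : κ ∈ gammaOneFiniteLevel ℚ (Ideal.span {(M : 𝓞 ℚ)}))
    (h : GL (Fin 2) (AdeleRing (𝓞 ℚ) ℚ)) :
    adelicAdjTrace N M d φ (h * GLn.ofFinite 2 ℚ κ) = adelicAdjTrace N M d φ h := by
  letI := Fintype.ofFinite (DegQuot N M d)
  set Γℝ : Subgroup (GL (Fin 2) ℝ) := ((Gamma1 M : Subgroup SL(2, ℤ)) : Subgroup (GL (Fin 2) ℝ)) with hΓℝ
  set βf := Rat.finGL (degBeta d : GL (Fin 2) ℚ) with hβf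
  -- `κ r_{q,f} = A_{q,f} k''_q`
  have hcov : ∀ q : DegQuot N M d, ∃ A : SL(2, ℤ), A ∈ Gamma1 M ∧ ∃ k'' ∈ adjLevel N M d,
      Rat.finGL (mapGL ℚ A) * k'' = κ * Rat.finGL (mapGL ℚ (slOf M q.out)) := fun q =>
    exists_gamma1_finGL_mul_mem_adjLevel (mul_mem hκ (Rat.finGL_mapGL_mem (slOf_mem q.out)))
  choose A hA k'' hk'' hAk using hcov
  -- the induced self-map of the index set
  let σ : DegQuot N M d → DegQuot N M d := fun q =>
    QuotientGroup.mk (⟨mapGL ℝ (A q), Subgroup.mem_map_of_mem _ (hA q)⟩ : Γℝ)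
  have hσrep : ∀ q, (Rat.finGL (mapGL ℚ (A q)))⁻¹ * Rat.finGL (mapGL ℚ (slOf M (σ q).out)) ∈ adjLevel N M d := by
    intro q
    refine finGL_mem_adjLevel_of_mem_conjLevel (hA q) (slOf_mem _) ?_
    have hq : (QuotientGroup.mk (⟨mapGL ℝ (A q), Subgroup.mem_map_of_mem _ (hA q)⟩ : Γℝ) : DegQuot N M d) =
        QuotientGroup.mk (σ q).out := (QuotientGroup.out_eq' (σ q)).symm
    have hq' := QuotientGroup.eq.1 hq
    rw [Subgroup.mem_subgroupOf] at hq'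
    simpa only [Subgroup.coe_mul, Subgroup.coe_inv, mapGL_slOf] using hq'
  have hσinj : Function.Injective σ := by
    intro q₁ q₂ h12
    -- `r_{q₁,f}⁻¹ r_{q₂,f} ∈ K''`
    have hmem : (Rat.finGL (mapGL ℚ (slOf M q₁.out)))⁻¹ * Rat.finGL (mapGL ℚ (slOf M q₂.out)) ∈ adjLevel N M d := by
      have e1 : Rat.finGL (mapGL ℚ (slOf M q₁.out)) = κ⁻¹ * (Rat.finGL (mapGL ℚ (A q₁)) * k'' q₁) := by
        rw [hAk, inv_mul_cancel_left]
      have e2 : Rat.finGL (mapGL ℚ (slOf M q₂.out)) = κ⁻¹ * (Rat.finGL (mapGL ℚ (A q₂)) * k'' q₂) := by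
        rw [hAk, inv_mul_cancel_left]
      have h3 : (Rat.finGL (mapGL ℚ (A q₁)))⁻¹ * Rat.finGL (mapGL ℚ (A q₂)) ∈ adjLevel N M d := by
        have h4 := hσrep q₁
        have h5 := hσrep q₂
        rw [h12] at h4
        have h6 := mul_mem h4 (inv_mem h5)
        rwa [mul_assoc, _root_.mul_inv_rev, inv_inv, mul_inv_cancel_left] at h6
      have e3 : (Rat.finGL (mapGL ℚ (slOf M q₁.out)))⁻¹ * Rat.finGL (mapGL ℚ (slOf M q₂.out)) =
          (k'' q₁)⁻¹ * ((Rat.finGL (mapGL ℚ (A q₁)))⁻¹ * Rat.finGL (mapGL ℚ (A q₂))) * k'' q₂ := by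
        rw [e1, e2]; group
      rw [e3]
      exact mul_mem (mul_mem (inv_mem (hk'' q₁)) h3) (hk'' q₂)
    have hconj := mem_conjLevel_of_finGL_mem_adjLevel (N := N) (d := d) hmem
    rw [mapGL_slOf, mapGL_slOf] at hconj
    rw [← QuotientGroup.out_eq' q₁, ← QuotientGroup.out_eq' q₂]
    exact QuotientGroup.eq.2 (by rw [Subgroup.mem_subgroupOf]; exact hconj)
  have hσbij : Function.Bijective σ := Finite.injective_iff_bijective.1 hσinj
  -- reindex the sum along `σ`
  unfold adelicAdjTrace
  refine Fintype.sum_bijective σ hσbij _ _ fun q => ?_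
  rw [degElt, degElt, mul_assoc h, ← map_mul, ← mul_assoc κ]
  -- `κ r_{q,f} β_f⁻¹ ~ A_{q,f} β_f⁻¹ ~ r_{σ q,f} β_f⁻¹`
  have step1 : (Rat.finGL (mapGL ℚ (A q)))⁻¹ * (κ * Rat.finGL (mapGL ℚ (slOf M q.out))) ∈ adjLevel N M d := by
    rw [← hAk, inv_mul_cancel_left]
    exact hk'' q
  rw [apply_mul_ofFinite_eq_of_inv_mul_mem_adjLevel hφ step1,
    ← apply_mul_ofFinite_eq_of_inv_mul_mem_adjLevel hφ (hσrep q)]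

/-- Left `GL₂(ℚ)`-invariance passes to the trace (termwise). [folklore] -/
theorem adelicAdjTrace_ofGlobal_mul {φ : GL (Fin 2) (AdeleRing (𝓞 ℚ) ℚ) → ℂ}
    (hφ : ∀ (γ : GL (Fin 2) ℚ) (g : GL (Fin 2) (AdeleRing (𝓞 ℚ) ℚ)), φ (GLn.ofGlobal 2 ℚ γ * g) = φ g)
    (γ : GL (Fin 2) ℚ) (h : GL (Fin 2) (AdeleRing (𝓞 ℚ) ℚ)) :
    adelicAdjTrace N M d φ (GLn.ofGlobal 2 ℚ γ * h) = adelicAdjTrace N M d φ h := by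
  unfold adelicAdjTrace
  refine Finset.sum_congr rfl fun q _ => ?_
  rw [mul_assoc, hφ]

/-- The trace of a member of a space `C` stable under right translation by `GL₂(𝔸_ℚ^∞)` lies in
`C`. [folklore] -/
theorem adelicAdjTrace_mem {C : Submodule ℂ (GL (Fin 2) (AdeleRing (𝓞 ℚ) ℚ) → ℂ)}
    (hC : ∀ (x : GL (Fin 2) (FiniteAdeleRing (𝓞 ℚ) ℚ)), ∀ φ ∈ C,
      (fun h => φ (h * GLn.ofFinite 2 ℚ x)) ∈ C)
    {φ : GL (Fin 2) (AdeleRing (𝓞 ℚ) ℚ) → ℂ} (hφ : φ ∈ C) :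
    adelicAdjTrace N M d φ ∈ C := by
  letI := Fintype.ofFinite (DegQuot N M d)
  have e : adelicAdjTrace N M d φ = ∑ q : DegQuot N M d, fun h => φ (h * GLn.ofFinite 2 ℚ (degElt N M d q)) := by
    funext h
    unfold adelicAdjTrace
    rw [Finset.sum_apply]
  rw [e]
  exact Submodule.sum_mem _ fun q _ => hC _ φ hφ

/-! ### The trace of `φ_u` at the archimedean points -/

variable {k : ℤ}

/-- `archLift` of a finite sum. [folklore] -/
theorem archLift_finset_sum {ι : Type*} (s : Finset ι) (F : ι → ℍ → ℂ) (g : GL (Fin 2) ℝ) :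
    archLift k (∑ i ∈ s, F i) g = ∑ i ∈ s, archLift k (F i) g := by
  simp only [archLift_apply, SlashAction.sum_slash, Finset.sum_apply, Finset.sum_mul]

/-- **`archLift k u (β r⁻¹ g) = (√d)^{2-k} archLift k ((u ∣ β) ∣ r⁻¹) g`** for `det r = 1`
(`|det(β r⁻¹ g)| = d |det g|`, and the slash action is an action). [cite: Gelbart1975, (3.4)] -/
theorem archLift_glCast_degBeta_mul (u : ℍ → ℂ) {r : GL (Fin 2) ℝ} (hr : r.det.val = 1) (g : GL (Fin 2) ℝ) :
    archLift k u (glCast (degBeta d : GL (Fin 2) ℚ) * r⁻¹ * g) =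
      ((Real.sqrt d : ℝ) : ℂ) ^ (2 - k) * archLift k ((u ∣[k] glCast (degBeta d : GL (Fin 2) ℚ)) ∣[k] r⁻¹) g := by
  rw [archLift_apply, archLift_apply, SlashAction.slash_mul, SlashAction.slash_mul, map_mul, map_mul,
    map_inv, Units.val_mul, Units.val_mul, Units.val_inv_eq_inv_val, hr, inv_one, mul_one,
    det_glCast_degBeta, abs_mul, abs_of_nonneg (Nat.cast_nonneg d),
    Real.sqrt_mul (Nat.cast_nonneg d), Complex.ofReal_mul, mul_zpow]
  ring

/-- **The summand at `(g, 1)`**: `φ_u((g, 1) · (1, A_f β_f⁻¹)) = archLift k u (β A⁻¹ g)` for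
`A ∈ SL₂(ℤ)` and `det g > 0` — multiply on the left by the global element `β A⁻¹`, whose finite part
cancels `A_f β_f⁻¹` and whose archimedean part is `β A⁻¹` (Gelbart 1975, proof of Lemma 3.7).
[cite: Gelbart1975, Lemma 3.7] -/
theorem adelicLiftFun_ofRealGL_mul_ofFinite_finGL (u : CuspForm (Gamma1 N) k) (A : SL(2, ℤ))
    {g : GL (Fin 2) ℝ} (hg : 0 < g.det.val) :
    adelicLiftFun N k ⇑u (Rat.ofRealGL 2 g *
        GLn.ofFinite 2 ℚ (Rat.finGL (mapGL ℚ A) * (Rat.finGL (degBeta d : GL (Fin 2) ℚ))⁻¹)) =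
      archLift k ⇑u (glCast (degBeta d : GL (Fin 2) ℚ) * (mapGL ℝ A : GL (Fin 2) ℝ)⁻¹ * g) := by
  set β : GL (Fin 2) ℚ := (degBeta d : GL (Fin 2) ℚ) with hβ
  set γ : GL (Fin 2) ℚ := β * (mapGL ℚ A)⁻¹ with hγ
  have hglγ : glCast γ = glCast β * (mapGL ℝ A : GL (Fin 2) ℝ)⁻¹ := by
    rw [hγ, glCast_mul, glCast_inv, glCast_mapGL]
  have hfin : Rat.finGL γ * (Rat.finGL (mapGL ℚ A) * (Rat.finGL β)⁻¹) = 1 := by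
    rw [hγ, map_mul, map_inv]; group
  have e : GLn.ofGlobal 2 ℚ γ * (Rat.ofRealGL 2 g * GLn.ofFinite 2 ℚ (Rat.finGL (mapGL ℚ A) * (Rat.finGL β)⁻¹)) =
      Rat.ofRealGL 2 (glCast γ * g) := by
    rw [Rat.ofGlobal_eq_ofRealGL_mul_ofFinite γ, mul_assoc, ← mul_assoc (GLn.ofFinite 2 ℚ (Rat.finGL γ)),
      ← Rat.ofRealGL_mul_ofFinite_comm, mul_assoc, ← mul_assoc (Rat.ofRealGL 2 (glCast γ)),
      ← map_mul (GLn.ofFinite 2 ℚ), hfin, map_one, mul_one, ← map_mul]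
  have hdet : 0 < (glCast γ * g).det.val := by
    rw [map_mul, Units.val_mul, hglγ, map_mul, map_inv, Units.val_mul, Units.val_inv_eq_inv_val,
      det_glCast_degBeta, Rat.det_mapGL_real, inv_one, mul_one]
    exact mul_pos (Nat.cast_pos.mpr (NeZero.pos d)) hg
  rw [← adelicLiftFun_ofGlobal_mul u γ, e, adelicLiftFun_ofRealGL u hdet, hglγ]

/-- **The trace of `φ_u` at the archimedean points is the lift of the adjoint degeneracy map**:
`adelicAdjTrace N M d φ_u ((g, 1)) = (√d)^{2-k} φ_{[Γ₁(N) β Γ₁(M)] u}((g, 1))` for `det g > 0`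
(summand by summand, `adelicLiftFun_ofRealGL_mul_ofFinite_finGL` and `archLift_glCast_degBeta_mul`;
the classical side is Mathlib's trace `∑_q (u ∣ β) ∣ r_q⁻¹`). [cite: Gelbart1975, Lemma 3.7]
[cite: DiamondShurman2005, §5.1] -/
theorem adelicAdjTrace_adelicLiftFun_ofRealGL (u : CuspForm (Gamma1 N) k) {g : GL (Fin 2) ℝ} (hg : 0 < g.det.val) :
    adelicAdjTrace N M d (adelicLiftFun N k ⇑u) (Rat.ofRealGL 2 g) =
      ((Real.sqrt d : ℝ) : ℂ) ^ (2 - k) * adelicLiftFun M k ⇑(adjDegeneracyMap1 N M d k u) (Rat.ofRealGL 2 g) := by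
  letI := Fintype.ofFinite (DegQuot N M d)
  set Γℝ : Subgroup (GL (Fin 2) ℝ) := ((Gamma1 M : Subgroup SL(2, ℤ)) : Subgroup (GL (Fin 2) ℝ)) with hΓℝ
  set β' : GL (Fin 2) ℝ := glCast (degBeta d : GL (Fin 2) ℚ) with hβ'
  -- the classical side: Mathlib's trace of `u ∣ β`
  have hclass : (⇑(adjDegeneracyMap1 N M d k u) : ℍ → ℂ) =
      ∑ q : DegQuot N M d, SlashInvariantForm.quotientFunc (CuspForm.translate u β') q := by
    change (⇑(cuspHeckeCorrespondenceₗ ((Gamma1 N : Subgroup SL(2, ℤ)) : Subgroup (GL (Fin 2) ℝ)) Γℝ k (degBeta d) u) : ℍ → ℂ) = _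
    change (⇑(SlashInvariantForm.trace Γℝ (CuspForm.translate u β')) : ℍ → ℂ) = _
    rw [SlashInvariantForm.coe_trace]
  rw [adelicLiftFun_ofRealGL _ hg, hclass, archLift_finset_sum, Finset.mul_sum]
  unfold adelicAdjTrace
  refine Finset.sum_congr rfl fun q _ => ?_
  have hr : ((q.out : Γℝ) : GL (Fin 2) ℝ).det.val = 1 := by
    rw [← mapGL_slOf q.out]
    exact Rat.det_mapGL_real _
  have hq : SlashInvariantForm.quotientFunc (CuspForm.translate u β') q =
      (⇑u ∣[k] β') ∣[k] ((q.out : Γℝ) : GL (Fin 2) ℝ)⁻¹ := by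
    conv_lhs => rw [← QuotientGroup.out_eq' q]
    exact SlashInvariantForm.quotientFunc_mk (CuspForm.translate u β') q.out
  rw [degElt, adelicLiftFun_ofRealGL_mul_ofFinite_finGL u _ hg, mapGL_slOf, archLift_glCast_degBeta_mul _ hr, hq]

/-- **Adelisation of the adjoint degeneracy map**: for `u ∈ S_k(Γ₁(N))`,
`adelicAdjTrace N M d φ_u = (√d)^{2-k} · φ_{[Γ₁(N) diag(1,d) Γ₁(M)] u}` on `GL₂(𝔸_ℚ)` — both sides
are left `GL₂(ℚ)`-invariant and right `{1} × K₁(M)`-invariant and they agree at the `(g, 1)`,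
`det g > 0` (Gelbart 1975, Lemma 3.7 and its proof, for a double coset between two levels).
[cite: Gelbart1975, Lemma 3.7] [cite: Li1975, §2] -/
theorem adelicAdjTrace_adelicLiftFun (u : CuspForm (Gamma1 N) k) :
    adelicAdjTrace N M d (adelicLiftFun N k ⇑u) =
      fun h => ((Real.sqrt d : ℝ) : ℂ) ^ (2 - k) * adelicLiftFun M k ⇑(adjDegeneracyMap1 N M d k u) h := by
  refine eq_of_invariant_of_ofRealGL (M := M)
    (adelicAdjTrace_ofGlobal_mul (adelicLiftFun_ofGlobal_mul u))
    (fun γ g => by simp only [adelicLiftFun_ofGlobal_mul])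
    (fun κ hκ g => adelicAdjTrace_mul_ofFinite (fun κ' hκ' g' =>
      adelicLiftFun_mul_of_archGL_eq_one u (Rat.archGL_ofFinite κ') (by rwa [GLn.sndHom_ofFinite]) g') hκ g)
    (fun κ hκ g => by
      simp only [adelicLiftFun_mul_of_archGL_eq_one _ (Rat.archGL_ofFinite κ) (by rwa [GLn.sndHom_ofFinite])])
    (fun g hg => adelicAdjTrace_adelicLiftFun_ofRealGL u hg)

/-! ### The level of a `K₁`-line is new -/

/-- **`[Γ₁(N) diag(1,d) Γ₁(M)] u = 0` when `φ_u` lies in a finite-adelically stable space without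
non-zero `K₁(M)`-invariants.** The trace of `φ_u` lies in `C` and is `{1} × K₁(M)`-invariant, hence
`0`; it is `(√d)^{2-k} φ_{[Γ₁(N) β Γ₁(M)] u}`, and `f ↦ φ_f` is injective (Gelbart 1975, Thm. 5.19 (b)
with Remark 4.25: the level of the new vector is the conductor; Casselman 1973, Thm. 1).
[cite: Gelbart1975, Thm. 5.19 and Remark 4.25] [cite: Casselman1973, Thm. 1] -/
theorem adjDegeneracyMap1_eq_zero_of_forall_fixed (u : CuspForm (Gamma1 N) k)
    {C : Submodule ℂ (GL (Fin 2) (AdeleRing (𝓞 ℚ) ℚ) → ℂ)}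
    (hC : ∀ (x : GL (Fin 2) (FiniteAdeleRing (𝓞 ℚ) ℚ)), ∀ φ ∈ C,
      (fun h => φ (h * GLn.ofFinite 2 ℚ x)) ∈ C)
    (hu : adelicLiftFun N k ⇑u ∈ C)
    (hM : ∀ φ ∈ C, (∀ κ ∈ gammaOneFiniteLevel ℚ (Ideal.span {(M : 𝓞 ℚ)}),
      ∀ h : GL (Fin 2) (AdeleRing (𝓞 ℚ) ℚ), φ (h * GLn.ofFinite 2 ℚ κ) = φ h) → φ = 0) :
    adjDegeneracyMap1 N M d k u = 0 := by
  have hT : adelicAdjTrace N M d (adelicLiftFun N k ⇑u) = 0 :=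
    hM _ (adelicAdjTrace_mem hC hu) fun κ hκ h => adelicAdjTrace_mul_ofFinite (fun κ' hκ' g' =>
      adelicLiftFun_mul_of_archGL_eq_one u (Rat.archGL_ofFinite κ') (by rwa [GLn.sndHom_ofFinite]) g') hκ h
  rw [adelicAdjTrace_adelicLiftFun u] at hT
  have hc : ((Real.sqrt d : ℝ) : ℂ) ^ (2 - k) ≠ 0 :=
    zpow_ne_zero _ (by exact_mod_cast (Real.sqrt_pos.2 (Nat.cast_pos.mpr (NeZero.pos d))).ne')
  refine CuspForm.eq_zero_of_adelicLiftFun_eq_zero (M := M) ?_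
  funext h
  have hh := congrFun hT h
  simp only [Pi.zero_apply, mul_eq_zero, hc, false_or] at hh
  exact hh

/-- **The level of a `K₁`-line is new.** If `φ_u` (`u ∈ S_k(Γ₁(N))`) lies in a space `C` of
functions on `GL₂(𝔸_ℚ)` stable under right translation by `GL₂(𝔸_ℚ^∞)` in which, for every proper
divisor `M` of `N`, only `0` is right `{1} × K₁(M)`-invariant, then `u ∈ S_k(Γ₁(N))^{new}`
(`newSubspace1 N k = ⋂ ker [Γ₁(N) diag(1,d) Γ₁(M)]`). For `C` an irreducible space of cusp forms and
`N` the least level with `C^{K₁(N)} ≠ 0` this is the classical half of "the conductor of `π` is the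
level of its newform" (Gelbart 1975, Thm. 5.19 (b), Remark 4.25; Casselman 1973, Thm. 1).
[cite: Gelbart1975, Thm. 5.19 and Remark 4.25] [cite: Casselman1973, Thm. 1] [cite: Li1975, Thm. 3] -/
theorem mem_newSubspace1_of_forall_fixed (u : CuspForm (Gamma1 N) k)
    {C : Submodule ℂ (GL (Fin 2) (AdeleRing (𝓞 ℚ) ℚ) → ℂ)}
    (hC : ∀ (x : GL (Fin 2) (FiniteAdeleRing (𝓞 ℚ) ℚ)), ∀ φ ∈ C,
      (fun h => φ (h * GLn.ofFinite 2 ℚ x)) ∈ C)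
    (hu : adelicLiftFun N k ⇑u ∈ C)
    (hmin : ∀ M ∈ N.properDivisors, ∀ φ ∈ C,
      (∀ κ ∈ gammaOneFiniteLevel ℚ (Ideal.span {(M : 𝓞 ℚ)}),
        ∀ h : GL (Fin 2) (AdeleRing (𝓞 ℚ) ℚ), φ (h * GLn.ofFinite 2 ℚ κ) = φ h) → φ = 0) :
    u ∈ newSubspace1 N k := by
  rw [newSubspace1, Submodule.mem_iInf]
  intro Md
  rw [LinearMap.mem_ker]
  exact adjDegeneracyMap1_eq_zero_of_forall_fixed u hC hu (hmin Md.1.1 Md.2.1)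

end Trace

end Literature.NumberTheory.Automorphic

end
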